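import Mathlib
import Summits.NavierStokesRegularity.NavierStokesRegularity.Theorems.FilamentSkeletonRssDefectColumnGateLogCutoff

/-!
# Route `FilamentSkeletonRss` · crux `TransverseReduction1AG` (stmt-NavierStokesRegularity-27853) · line `defect_column_gate_1AG` —
# THE FAR-FIELD PROFILE `F_L = χ₀(log x/L)·x⁻⁴`, its first four derivatives, uniform bounds; the Gaussian factor

Helper file (`--supports stmt-NavierStokesRegularity-27853 --as helper`; LEAD of 27853, lane ns-filament-21221-p1 g10).  Second third of the owed
construction `FarFieldQuasimodes1A` (memo S2A-FALSE-FARFIELD-27853-g10.md §6): the x₁-profile of the quasimode and the x₂-Gaussian, with the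
bounds that make the quasimode ratio `O(1/L)`.  HONEST FRAMING: elementary real analysis; MODEL rung, negative side; nothing here bears on
Navier–Stokes regularity.

* `farShape L k` — the Euler iterates `ψ₀ = χ₀`, `ψ_{k+1} = ψ_k′/L − (4+k)ψ_k`; `farProfile L k x = ψ_k(log x/L)·x^{-(4+k)}`;
  `hasDerivAt_farProfile` (`F_k′ = F_{k+1}` everywhere, `0 < L`), `iterate_deriv_farProfile`, `contDiff_farProfile`, support in `e^L ≤ |x| ≤ e^{2L}`;
* `exists_bound_farShape` — `sup_t |ψ_k^{(j)}(t)| ≤ M_{k,j}` UNIFORMLY IN `L ≥ 1`; hence `|x|^{4+k}|F_k(x)| ≤ M` (`exists_bound_farProfile`);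
* `gaussE lam y = e^{−lam y²/2}`: `hasDerivAt_gaussE_mul` (`(p·E)′ = (p′ − lam·y·p)·E`) and the weight bound `(1+y²)²|y|^j e^{−lam y²/2} ≤ C(lam)`, `j ≤ 5`
  (`weight_pow_gaussE_le`).
-/

set_option linter.dupNamespace false

noncomputable section

namespace Summit.NavierStokesRegularity.NavierStokesRegularity.Theorems.DefectColumnGate

open scoped Topology ContDiff
open Set Function Filter

/-! ## 1. Euler iterates of the bump and the profile -/

/-- The Euler iterates of the bump: `ψ₀ = χ₀`, `ψ_{k+1} = eulerStep L (4+k) ψ_k = ψ_k′/L − (4+k)·ψ_k`. -/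
def farShape (L : ℝ) : ℕ → ℝ → ℝ
  | 0 => bump12
  | k + 1 => eulerStep L (4 + k) (farShape L k)

/-- The far-field profile and its derivatives: `F_k(x) = ψ_k(log x/L)·(x^{4+k})⁻¹` (`F_0 = χ₀(log x/L)x⁻⁴`, `F_{k+1} = F_k′`). -/
def farProfile (L : ℝ) (k : ℕ) (x : ℝ) : ℝ := farShape L k (Real.log x / L) * (x ^ (4 + k))⁻¹

/-- The Euler iterates are smooth. -/
theorem contDiff_farShape (L : ℝ) (k : ℕ) {n : ℕ∞} : ContDiff ℝ n (farShape L k) := by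
  induction k generalizing n with
  | zero => exact contDiff_bump12
  | succ k ih =>
    simp only [farShape]
    exact contDiff_eulerStep (n := n) (ih (n := n + 1)) L (4 + k)

/-- The Euler iterates vanish below `1` … -/
theorem farShape_eq_zero_of_lt_one (L : ℝ) (k : ℕ) {t : ℝ} (ht : t < 1) : farShape L k t = 0 := by
  induction k generalizing t with
  | zero => exact bump12_eq_zero_of_le_one ht.le
  | succ k ih => exact eulerStep_eq_zero_of_lt_one (fun s hs => ih hs) L (4 + k) ht

/-- … and above `2` … -/
theorem farShape_eq_zero_of_two_lt (L : ℝ) (k : ℕ) {t : ℝ} (ht : 2 < t) : farShape L k t = 0 := by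
  induction k generalizing t with
  | zero => exact bump12_eq_zero_of_two_le ht.le
  | succ k ih =>
    have h : farShape L k =ᶠ[𝓝 t] fun _ => (0:ℝ) := (eventually_gt_nhds ht).mono fun s hs => ih hs
    simp only [farShape, eulerStep]
    rw [h.deriv_eq, deriv_const, ih ht]; simp

/-- … hence (continuity) also at `t = 1` … -/
theorem farShape_eq_zero_of_le_one (L : ℝ) (k : ℕ) {t : ℝ} (ht : t ≤ 1) : farShape L k t = 0 := by
  rcases ht.lt_or_eq with h | rfl
  · exact farShape_eq_zero_of_lt_one L k h
  · have hc : ContinuousAt (farShape L k) 1 := (contDiff_farShape L k (n := 0)).continuous.continuousAt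
    have h1 : Tendsto (farShape L k) (𝓝[<] (1:ℝ)) (𝓝 (farShape L k 1)) := hc.tendsto.mono_left nhdsWithin_le_nhds
    have h2 : Tendsto (farShape L k) (𝓝[<] (1:ℝ)) (𝓝 0) :=
      tendsto_const_nhds.congr' (eventually_nhdsWithin_of_forall fun s hs => (farShape_eq_zero_of_lt_one L k hs).symm)
    exact tendsto_nhds_unique h1 h2

/-- … and at `t = 2`. -/
theorem farShape_eq_zero_of_two_le (L : ℝ) (k : ℕ) {t : ℝ} (ht : 2 ≤ t) : farShape L k t = 0 := by
  rcases ht.lt_or_eq with h | rfl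
  · exact farShape_eq_zero_of_two_lt L k h
  · have hc : ContinuousAt (farShape L k) 2 := (contDiff_farShape L k (n := 0)).continuous.continuousAt
    have h1 : Tendsto (farShape L k) (𝓝[>] (2:ℝ)) (𝓝 (farShape L k 2)) := hc.tendsto.mono_left nhdsWithin_le_nhds
    have h2 : Tendsto (farShape L k) (𝓝[>] (2:ℝ)) (𝓝 0) :=
      tendsto_const_nhds.congr' (eventually_nhdsWithin_of_forall fun s hs => (farShape_eq_zero_of_two_lt L k hs).symm)
    exact tendsto_nhds_unique h1 h2

/-- **`F_k′ = F_{k+1}` at every point** (`0 < L`). -/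
theorem hasDerivAt_farProfile {L : ℝ} (hL : 0 < L) (k : ℕ) (x : ℝ) :
    HasDerivAt (farProfile L k) (farProfile L (k + 1) x) x := by
  have h := hasDerivAt_logScale' ((contDiff_farShape L k (n := 1)).differentiable (by norm_num))
    (fun t ht => farShape_eq_zero_of_lt_one L k ht) hL (4 + k) x
  have e : farProfile L (k + 1) x = eulerStep L (4 + k) (farShape L k) (Real.log x / L) * (x ^ (4 + k + 1))⁻¹ := rfl
  rw [e]
  exact h

/-- `deriv F_k = F_{k+1}`. -/
theorem deriv_farProfile {L : ℝ} (hL : 0 < L) (k : ℕ) : deriv (farProfile L k) = farProfile L (k + 1) :=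
  funext fun x => (hasDerivAt_farProfile hL k x).deriv

/-- `F₀^{(j)} = F_j`. -/
theorem iterate_deriv_farProfile {L : ℝ} (hL : 0 < L) (j : ℕ) : deriv^[j] (farProfile L 0) = farProfile L j := by
  induction j with
  | zero => rfl
  | succ j ih => rw [Function.iterate_succ_apply', ih, deriv_farProfile hL]

/-- The profiles are smooth on `ℝ`. -/
theorem contDiff_farProfile {L : ℝ} (hL : 0 < L) (k : ℕ) {n : ℕ∞} : ContDiff ℝ n (farProfile L k) :=
  contDiff_logScale (contDiff_farShape L k) (fun _ ht => farShape_eq_zero_of_lt_one L k ht) hL (4 + k)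

/-- The profiles are differentiable. -/
theorem differentiable_farProfile {L : ℝ} (hL : 0 < L) (k : ℕ) : Differentiable ℝ (farProfile L k) :=
  fun x => (hasDerivAt_farProfile hL k x).differentiableAt

/-- Support, inner edge: `F_k(x) = 0` for `|x| ≤ e^L`. -/
theorem farProfile_eq_zero_of_abs_le {L : ℝ} (hL : 0 < L) (k : ℕ) {x : ℝ} (hx : |x| ≤ Real.exp L) : farProfile L k x = 0 := by
  have hlog : Real.log x ≤ L := by
    rcases eq_or_ne x 0 with rfl | hx0
    · rw [Real.log_zero]; exact hL.le
    · rw [← Real.log_abs]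
      calc Real.log |x| ≤ Real.log (Real.exp L) := Real.log_le_log (abs_pos.2 hx0) hx
        _ = L := Real.log_exp L
  rw [farProfile, farShape_eq_zero_of_le_one L k ((div_le_one hL).2 hlog), zero_mul]

/-- Support, outer edge: `F_k(x) = 0` for `e^{2L} ≤ |x|`. -/
theorem farProfile_eq_zero_of_le_abs {L : ℝ} (hL : 0 < L) (k : ℕ) {x : ℝ} (hx : Real.exp (2 * L) ≤ |x|) : farProfile L k x = 0 := by
  have hx0 : x ≠ 0 := by
    intro h; rw [h, abs_zero] at hx; exact absurd hx (not_le.2 (Real.exp_pos _))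
  have hlog : 2 * L ≤ Real.log x := by
    rw [← Real.log_abs]
    calc 2 * L = Real.log (Real.exp (2 * L)) := (Real.log_exp _).symm
      _ ≤ Real.log |x| := Real.log_le_log (Real.exp_pos _) hx
  rw [farProfile, farShape_eq_zero_of_two_le L k (by rwa [le_div_iff₀ hL]), zero_mul]

/-- The profiles have compact support. -/
theorem hasCompactSupport_farProfile {L : ℝ} (hL : 0 < L) (k : ℕ) : HasCompactSupport (farProfile L k) := by
  refine HasCompactSupport.of_support_subset_isCompact (isCompact_Icc (a := -Real.exp (2 * L)) (b := Real.exp (2 * L))) ?_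
  intro x hx
  rw [Function.mem_support] at hx
  rw [mem_Icc, ← abs_le]
  by_contra h
  exact hx (farProfile_eq_zero_of_le_abs hL k (not_le.1 h).le)

/-! ## 2. Uniform bounds (`L ≥ 1`) -/

/-- Derivatives commute with the Euler step: `(eulerStep L n ψ)′ = eulerStep L n ψ′` (`ψ ∈ C²`). -/
theorem deriv_eulerStep {ψ : ℝ → ℝ} (hψ : ContDiff ℝ (2 : ℕ) ψ) (L : ℝ) (n : ℕ) :
    deriv (eulerStep L n ψ) = eulerStep L n (deriv ψ) := by
  have hd : ContDiff ℝ 1 (deriv ψ) := by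
    have := hψ.iterate_deriv' 1 1; simpa using this
  funext t
  have h1 : DifferentiableAt ℝ (deriv ψ) t := hd.differentiable (by norm_num) t
  have h0 : DifferentiableAt ℝ ψ t := hψ.differentiable (by norm_num) t
  have e : eulerStep L n ψ = fun s => deriv ψ s / L - (n:ℝ) * ψ s := rfl
  rw [e, deriv_fun_sub (h1.div_const L) (h0.const_mul _), deriv_div_const, deriv_const_mul _ h0]
  rfl

/-- Iterated form: `(eulerStep L n ψ)^{(j)} = eulerStep L n ψ^{(j)}` (`ψ ∈ C^∞`). -/
theorem iterate_deriv_eulerStep {ψ : ℝ → ℝ} (hψ : ContDiff ℝ ∞ ψ) (L : ℝ) (n j : ℕ) :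
    deriv^[j] (eulerStep L n ψ) = eulerStep L n (deriv^[j] ψ) := by
  induction j with
  | zero => rfl
  | succ j ih =>
    rw [Function.iterate_succ_apply', ih, deriv_eulerStep (contDiff_infty.1 (hψ.iterate_deriv j) 2) L n,
      ← Function.iterate_succ_apply' deriv j ψ]

/-- **Uniform bounds for the Euler iterates and all their derivatives**: for each `k, j` there is `M` with `|ψ_k^{(j)}(t)| ≤ M` for all `t` and
ALL `L ≥ 1` (each Euler step costs `sup|ψ′|/L + (4+k)·sup|ψ| ≤ sup|ψ′| + (4+k)·sup|ψ|`). -/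
theorem exists_bound_farShape (k j : ℕ) : ∃ M : ℝ, ∀ L : ℝ, 1 ≤ L → ∀ t, |deriv^[j] (farShape L k) t| ≤ M := by
  induction k generalizing j with
  | zero =>
    obtain ⟨M, hM⟩ := exists_bound_iteratedDeriv_bump12 j
    exact ⟨M, fun L _ t => by rw [← iteratedDeriv_eq_iterate]; exact hM t⟩
  | succ k ih =>
    obtain ⟨M₀, hM₀⟩ := ih j
    obtain ⟨M₁, hM₁⟩ := ih (j + 1)
    refine ⟨M₁ + (4 + k : ℕ) * M₀, fun L hL t => ?_⟩
    have hs : ContDiff ℝ ∞ (farShape L k) := contDiff_farShape L k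
    rw [show farShape L (k + 1) = eulerStep L (4 + k) (farShape L k) from rfl, iterate_deriv_eulerStep hs L (4 + k) j]
    have hA : ∀ s, |deriv^[j] (farShape L k) s| ≤ M₀ := hM₀ L hL
    have hA' : ∀ s, |deriv (deriv^[j] (farShape L k)) s| ≤ M₁ := fun s => by
      rw [← Function.iterate_succ_apply' deriv j]; exact hM₁ L hL s
    exact abs_eulerStep_le hA hA' (by rw [abs_of_pos (by linarith)]; exact hL) (4 + k) t

/-- **Weight neutrality of the profiles**: `|x|^{4+k}·|F_k(x)| ≤ M` for all `x`, uniformly in `L ≥ 1`. -/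
theorem exists_bound_farProfile (k : ℕ) : ∃ M : ℝ, ∀ L : ℝ, 1 ≤ L → ∀ x, |x| ^ (4 + k) * |farProfile L k x| ≤ M := by
  obtain ⟨M, hM⟩ := exists_bound_farShape k 0
  exact ⟨M, fun L hL x => abs_pow_mul_logScale_le (fun t => by simpa using hM L hL t) L (4 + k) x⟩

/-- The `1/L` term: the derivative OF THE SHAPE entering `F₁ = F₀′`, isolated: `x·F₀′(x) + 4F₀(x) = χ₀′(log x/L)/L · x⁻⁴`, and `|χ₀′| ≤ M`. -/
theorem farProfile_one_eq (L x : ℝ) :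
    farProfile L 1 x = (deriv bump12 (Real.log x / L) / L) * (x ^ 5)⁻¹ - 4 * (farProfile L 0 x * x⁻¹) := by
  simp only [farProfile, farShape, eulerStep]
  rcases eq_or_ne x 0 with rfl | hx
  · simp
  · field_simp
    ring

/-! ## 3. The Gaussian factor -/

/-- `E(y) = e^{−lam·y²/2}`. -/
def gaussE (lam y : ℝ) : ℝ := Real.exp (-(lam * y ^ 2 / 2))

/-- `E > 0`. -/
theorem gaussE_pos (lam y : ℝ) : 0 < gaussE lam y := Real.exp_pos _

/-- `E ≤ 1` for `lam ≥ 0`. -/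
theorem gaussE_le_one {lam : ℝ} (hlam : 0 ≤ lam) (y : ℝ) : gaussE lam y ≤ 1 := by
  rw [gaussE, Real.exp_le_one_iff]; nlinarith [sq_nonneg y]

/-- `E′ = −lam·y·E`. -/
theorem hasDerivAt_gaussE (lam y : ℝ) : HasDerivAt (gaussE lam) (-(lam * y) * gaussE lam y) y := by
  have h1 : HasDerivAt (fun y : ℝ => lam * y ^ 2 / 2) (lam * (2 * y) / 2) y := by
    have := ((hasDerivAt_pow 2 y).const_mul lam).div_const 2
    simpa using this
  have h : HasDerivAt (fun y : ℝ => -(lam * y ^ 2 / 2)) (-(lam * (2 * y) / 2)) y := h1.neg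
  have h2 := h.exp
  refine h2.congr_deriv ?_
  rw [gaussE]; ring

/-- `E` is smooth. -/
theorem contDiff_gaussE (lam : ℝ) {n : ℕ∞} : ContDiff ℝ n (gaussE lam) :=
  Real.contDiff_exp.comp (((contDiff_const (c := lam)).mul (contDiff_id.pow 2)).div_const 2).neg

/-- **Product rule against the Gaussian**: `(p·E)′ = (p′ − lam·y·p)·E`. -/
theorem hasDerivAt_mul_gaussE {p : ℝ → ℝ} {p' : ℝ} {lam y : ℝ} (hp : HasDerivAt p p' y) :
    HasDerivAt (fun y => p y * gaussE lam y) ((p' - lam * y * p y) * gaussE lam y) y := by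
  have h : HasDerivAt (fun y => p y * gaussE lam y) (p' * gaussE lam y + p y * (-(lam * y) * gaussE lam y)) y :=
    hp.mul (hasDerivAt_gaussE lam y)
  exact h.congr_deriv (by ring)

/-- Gaussian beats polynomial, quantitatively: `y^{10}·E(y) ≤ 120·(2/lam)^5` (`t⁵/5! ≤ e^t` at `t = lam y²/2`), `lam > 0`. -/
theorem pow_ten_mul_gaussE_le {lam : ℝ} (hlam : 0 < lam) (y : ℝ) : y ^ 10 * gaussE lam y ≤ 120 * (2 / lam) ^ 5 := by
  have hl : lam ≠ 0 := hlam.ne'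
  have ht : 0 ≤ lam * y ^ 2 / 2 := by positivity
  have h := Real.pow_div_factorial_le_exp (lam * y ^ 2 / 2) (n := 5) ht
  rw [show (Nat.factorial 5 : ℝ) = 120 by norm_num, div_le_iff₀ (by norm_num : (0:ℝ) < 120)] at h
  have hexp : 0 < Real.exp (lam * y ^ 2 / 2) := Real.exp_pos _
  have key : y ^ 10 * gaussE lam y = ((lam * y ^ 2 / 2) ^ 5 * (Real.exp (lam * y ^ 2 / 2))⁻¹) * (2 / lam) ^ 5 := by
    rw [gaussE, Real.exp_neg]
    have e1 : (lam * y ^ 2 / 2) ^ 5 * (2 / lam) ^ 5 = y ^ 10 := by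
      rw [← mul_pow, show lam * y ^ 2 / 2 * (2 / lam) = y ^ 2 by field_simp]
      ring
    rw [mul_assoc, mul_comm ((Real.exp _)⁻¹), ← mul_assoc, e1]
  have h3 : (lam * y ^ 2 / 2) ^ 5 * (Real.exp (lam * y ^ 2 / 2))⁻¹ ≤ 120 := by
    rw [mul_inv_le_iff₀ hexp]; linarith
  rw [key]
  have h4 : 0 ≤ (2 / lam) ^ 5 := by positivity
  nlinarith

/-- **The weight bound**: `(1 + y²)²·|y|^j·E(y) ≤ 4 + 480·(2/lam)^5` for `j ≤ 5`, `lam > 0`. -/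
theorem weight_pow_gaussE_le {lam : ℝ} (hlam : 0 < lam) {j : ℕ} (hj : j ≤ 5) (y : ℝ) :
    (1 + y ^ 2) ^ 2 * |y| ^ j * gaussE lam y ≤ 4 + 480 * (2 / lam) ^ 5 := by
  have hE := gaussE_pos lam y
  have hE1 := gaussE_le_one hlam.le y
  have hC : 0 ≤ 480 * (2 / lam) ^ 5 := by positivity
  by_cases hy : |y| ≤ 1
  · -- small `y`: everything ≤ 4
    have h1 : (1 + y ^ 2) ^ 2 ≤ 4 := by
      have : y ^ 2 ≤ 1 := by rw [← sq_abs]; exact pow_le_one₀ (abs_nonneg _) hy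
      nlinarith
    have h2 : |y| ^ j ≤ 1 := pow_le_one₀ (abs_nonneg _) hy
    calc (1 + y ^ 2) ^ 2 * |y| ^ j * gaussE lam y ≤ 4 * 1 * 1 := by
          gcongr
      _ ≤ 4 + 480 * (2 / lam) ^ 5 := by linarith
  · -- large `y`: `(1+y²)² |y|^j ≤ 4 y^4 |y|^5 ≤ 4 |y|^10 / |y|`, and `y^10 E ≤ 120 (2/lam)^5`
    rw [not_le] at hy
    have hy0 : 0 < |y| := lt_trans one_pos hy
    have h1 : (1 + y ^ 2) ^ 2 ≤ 4 * |y| ^ 4 := by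
      have : 1 ≤ y ^ 2 := by rw [← sq_abs]; exact one_le_pow₀ hy.le
      have e : |y| ^ 4 = (y ^ 2) ^ 2 := by rw [show (4:ℕ) = 2 * 2 from rfl, pow_mul, sq_abs]
      rw [e]; nlinarith
    have h2 : |y| ^ j ≤ |y| ^ 5 := pow_le_pow_right₀ hy.le hj
    have h3 : |y| ^ 4 * |y| ^ 5 ≤ |y| ^ 10 := by
      rw [← pow_add]; exact pow_le_pow_right₀ hy.le (by norm_num)
    have h4 : |y| ^ 10 * gaussE lam y ≤ 120 * (2 / lam) ^ 5 := by
      rw [show |y| ^ 10 = y ^ 10 by rw [show (10:ℕ) = 2 * 5 from rfl, pow_mul, sq_abs, ← pow_mul]]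
      exact pow_ten_mul_gaussE_le hlam y
    calc (1 + y ^ 2) ^ 2 * |y| ^ j * gaussE lam y ≤ 4 * |y| ^ 4 * |y| ^ 5 * gaussE lam y := by gcongr
      _ = 4 * (|y| ^ 4 * |y| ^ 5) * gaussE lam y := by ring
      _ ≤ 4 * |y| ^ 10 * gaussE lam y := by gcongr
      _ = 4 * (|y| ^ 10 * gaussE lam y) := by ring
      _ ≤ 4 * (120 * (2 / lam) ^ 5) := by gcongr
      _ ≤ 4 + 480 * (2 / lam) ^ 5 := by linarith

end Summit.NavierStokesRegularity.NavierStokesRegularity.Theorems.DefectColumnGate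

end
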